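import Literature.AlgebraicGeometry.Resolution.ProperModelsRegModel
import HarnessLib

/-!
# Dominance — DominationDichotomy, part 1: cofinal colours in the domination preorder of proper models
(decomp-res lens-6 gen 5; kernels for the residual `SandwichedResolve`, stmt-ResolutionOfSingularities-24572)

Order the proper models of a field extension `K/k` by DOMINATION (`Models.Dominates N M := Nonempty
(N.Hom M)`, Zariski–Samuel II, Ch. VI §17). Three proved ingredients: (1) domination is DIRECTED — the
join `J(M₁, M₂)` dominates both (tree `ProperModel.join/joinFst/joinSnd`; Zariski–Samuel VI §17 Lemma 6,
«the ordered sets of all complete models and of all projective models are directed sets»); (2)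
resolvability DESCENDS along domination (`Models.hasResolution_of_dominates`: resolve the dominator
with `ProperModel.exists_hom_isRegular_of_hasResolution`, compose, `Hom.hasResolution`); (3) the
pigeonhole `cofinal_or_cofinal_not`: in a directed preorder every predicate `P` has `P` cofinal or `¬P`
cofinal. Consequences proved here, for EVERY predicate `P` on the proper models of `K/k`:
`Models.bisection_absorbs` — the `P`-models are cofinal and the scope piece «every `P`-model has a
resolution» is EQUIVALENT to `Res_K` («every proper model of `K` has a resolution»), or the same for
`¬P`; the same inside the models over one FIXED model `R` (`Models.overModel_bisection_absorbs`).
Worked colours: regular models cofinal ⟺ `Res_K` (`cofinal_regular_iff_resK`); «lies over a regular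
proper model» (`DominatesRegular`) cofinal ⟺ `K` has a regular proper model (`RegModelAt`), its negation
cofinal ⟺ `K` has none; `SandwichResK := Res_K|DominatesRegular ⟺ Res_K` given one regular model
(`sandwichResK_iff_resK`), `Res_K ⟺ RegModelAt ∧ SandwichResK`; and the VACUOUS-HALF lemma
`restr_not_iff_forall`: for `Q ⊇ {resolvable}`, the piece `Res_K|¬Q` IS the existence statement
`∀ M, Q M`. Part 2 (`DominanceDominationDichotomy.lean`) links this to `ResolutionInChar` / the summit
and to route `Dominance` by name, and states the barrier reading. Everything is proved (0 sorry).
Sources: [ZariskiSamuel1960, Ch. VI §17, Lemma 6–7], [Piltant2013, Prop. 5.1], tree files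
`ProperModelsJoin`, `ProperModelsPatchingOfResolution`.
-/

noncomputable section


open CategoryTheory AlgebraicGeometry TopologicalSpace
open Literature.AlgebraicGeometry Literature.AlgebraicGeometry.Resolution

namespace Summit.ResolutionOfSingularities.ResolutionOfSingularities.Theorems.DominanceDominationDichotomy

universe u

/-! ## §1 The abstract layer: cofinal colours in a directed preorder -/

section Abstract

variable {D : Type*}

/-- `IsDirected' dom`: any two objects have a common dominator (a predicate ON the relation `dom`,
not a closed statement). [abstract layer · definition] -/
def IsDirected' (dom : D → D → Prop) : Prop :=
  ∀ a b : D, ∃ c, dom c a ∧ dom c b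

variable (dom : D → D → Prop)

/-- `Cofinal dom P`: every object `a` is dominated (`dom b a` reads "`b` dominates `a`") by some
object `b` satisfying `P`. [abstract layer · definition] [folklore] -/
def Cofinal (P : D → Prop) : Prop :=
  ∀ a, ∃ b, dom b a ∧ P b

variable {dom}

/-- **The cofinal-colour dichotomy.** In a directed preorder every predicate `P` has `P` cofinal or
`¬P` cofinal: if some `a₁` is dominated by no `P`-object, then for every `a` a common dominator of
`a₁` and `a` is a `¬P`-object dominating `a`. (Reflexivity and transitivity are not even needed.)
[folklore] -/
theorem cofinal_or_cofinal_not (hdir : IsDirected' dom) (P : D → Prop) :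
    Cofinal dom P ∨ Cofinal dom (fun x => ¬ P x) := by
  classical
  by_cases hP : Cofinal dom P
  · exact Or.inl hP
  · refine Or.inr fun a => ?_
    obtain ⟨a₁, ha₁⟩ : ∃ a₁, ∀ b, dom b a₁ → ¬ P b := by
      by_contra h'
      refine hP fun x => ?_
      by_contra hx
      exact h' ⟨x, fun b hb hPb => hx ⟨b, hb, hPb⟩⟩
    obtain ⟨c, hc₁, hc⟩ := hdir a₁ a
    exact ⟨c, hc, ha₁ c hc₁⟩

/-- It is never the case that BOTH colours fail to be cofinal. [folklore] -/
theorem not_both_noncofinal (hdir : IsDirected' dom) (P : D → Prop) :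
    ¬ (¬ Cofinal dom P ∧ ¬ Cofinal dom (fun x => ¬ P x)) := fun h =>
  (cofinal_or_cofinal_not hdir P).elim h.1 h.2

/-- A predicate holding on everything that dominates one fixed object `a₀` is cofinal (directedness).
[folklore] -/
theorem cofinal_of_forall_dominating (hdir : IsDirected' dom) {P : D → Prop} (a₀ : D)
    (h : ∀ b, dom b a₀ → P b) : Cofinal dom P := fun a => by
  obtain ⟨c, hc₀, hca⟩ := hdir a₀ a
  exact ⟨c, hca, h c hc₀⟩

/-- **Absorption.** If `R` descends along domination and `P` is cofinal, the `P`-restricted statement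
`∀ b, P b → R b` already gives the unrestricted `∀ a, R a`. [folklore] -/
theorem forall_of_cofinal {R P : D → Prop} (hanti : ∀ a b, dom b a → R b → R a)
    (hP : Cofinal dom P) (h : ∀ b, P b → R b) : ∀ a, R a := fun a => by
  obtain ⟨b, hb, hPb⟩ := hP a
  exact hanti a b hb (h b hPb)

/-- A cofinal colour's restricted statement is EQUIVALENT to the whole. [folklore] -/
theorem restricted_iff_all_of_cofinal {R P : D → Prop} (hanti : ∀ a b, dom b a → R b → R a)
    (hP : Cofinal dom P) : (∀ b, P b → R b) ↔ ∀ a, R a :=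
  ⟨forall_of_cofinal hanti hP, fun h b _ => h b⟩

/-- **Every bisection has an absorbing half.** For any predicate `P`: either `P` is cofinal and
`R|P ⟺ R`, or `¬P` is cofinal and `R|¬P ⟺ R`. [folklore] -/
theorem bisection_absorbs (hdir : IsDirected' dom) {R : D → Prop}
    (hanti : ∀ a b, dom b a → R b → R a) (P : D → Prop) :
    (Cofinal dom P ∧ ((∀ b, P b → R b) ↔ ∀ a, R a)) ∨
      (Cofinal dom (fun x => ¬ P x) ∧ ((∀ b, ¬ P b → R b) ↔ ∀ a, R a)) := by
  rcases cofinal_or_cofinal_not hdir P with h | h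
  · exact Or.inl ⟨h, restricted_iff_all_of_cofinal hanti h⟩
  · exact Or.inr ⟨h, restricted_iff_all_of_cofinal hanti h⟩

/-- The trivial bisection identity (recorded for contrast: this, unlike `bisection_absorbs`, carries no
information about which half is load-bearing). [folklore] -/
theorem all_iff_restricted_and_restricted_not {R : D → Prop} (P : D → Prop) :
    (∀ a, R a) ↔ (∀ b, P b → R b) ∧ (∀ b, ¬ P b → R b) := by
  classical
  refine ⟨fun h => ⟨fun b _ => h b, fun b _ => h b⟩, fun h a => ?_⟩
  by_cases hPa : P a
  · exact h.1 a hPa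
  · exact h.2 a hPa

end Abstract

/-! ## §2 The instance: proper models of a function field under domination -/

namespace Models

variable {k K : Type u} [Field k] [Field K] [Algebra k K]

/-- `Dominates N M`: there is a morphism of proper models `N → M` (`N` dominates `M`; Zariski–Samuel II,
Ch. VI §17). [cite: ZariskiSamuel1960, Ch. VI §17] -/
def Dominates (N M : ProperModel k K) : Prop :=
  Nonempty (N.Hom M)

/-- Domination is reflexive. [folklore] -/
theorem dominates_refl (M : ProperModel k K) : Dominates M M :=
  ⟨ProperModel.Hom.id M⟩

/-- Domination is transitive. [folklore] -/
theorem Dominates.trans {L N M : ProperModel k K} (h₁ : Dominates L N) (h₂ : Dominates N M) :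
    Dominates L M :=
  ⟨h₁.some.comp h₂.some⟩

/-- **Directedness**: the join `J(M₁, M₂)` dominates both (tree: `ProperModel.join`, `joinFst`,
`joinSnd`, PROVED). [cite: ZariskiSamuel1960, Ch. VI §17] -/
theorem dominates_directed : IsDirected' (Dominates (k := k) (K := K)) := fun M₁ M₂ =>
  ⟨ProperModel.join M₁ M₂, ⟨ProperModel.joinFst M₁ M₂⟩, ⟨ProperModel.joinSnd M₁ M₂⟩⟩

/-- **Resolvability descends along domination**: a resolution `N' → N` of the dominating model is a
regular proper model over `N` (tree: `exists_hom_isRegular_of_hasResolution`), hence over `M`, and a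
model dominated by a regular model has a resolution (tree: `Hom.hasResolution`). [folklore] -/
theorem hasResolution_of_dominates {N M : ProperModel k K} (h : Dominates N M)
    (hN : Scheme.HasResolution N.X) : Scheme.HasResolution M.X := by
  obtain ⟨φ⟩ := h
  obtain ⟨N', ψ, hN'⟩ := N.exists_hom_isRegular_of_hasResolution hN
  exact (ψ.comp φ).hasResolution hN'

/-- `HasResolution` is domination-antitone in the shape `forall_of_cofinal` wants. [folklore] -/
theorem hasResolution_antitone :
    ∀ M N : ProperModel k K, Dominates N M → Scheme.HasResolution N.X → Scheme.HasResolution M.X :=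
  fun _ _ h hN => hasResolution_of_dominates h hN

/-- `Res_K`: every proper model of `K/k` has a resolution of singularities (a predicate ON the
function field `K/k`, not a closed statement). [definition] -/
def ResK (k K : Type u) [Field k] [Field K] [Algebra k K] : Prop :=
  ∀ M : ProperModel k K, Scheme.HasResolution M.X

/-- `Res_K|P`: every proper model of `K/k` satisfying `P` has a resolution (a SCOPE PIECE). [folklore] -/
def ResKRestr (P : ProperModel k K → Prop) : Prop :=
  ∀ M : ProperModel k K, P M → Scheme.HasResolution M.X

/-- Cofinality of a class of proper models of `K/k` under domination. [folklore] -/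
abbrev ModelsCofinal (P : ProperModel k K → Prop) : Prop :=
  Cofinal Dominates P

/-- **Dichotomy for proper models**: for EVERY predicate, `P`-models are cofinal or `¬P`-models are.
[folklore] -/
theorem cofinal_or_cofinal_not (P : ProperModel k K → Prop) :
    ModelsCofinal P ∨ ModelsCofinal (fun M => ¬ P M) :=
  DominanceDominationDichotomy.cofinal_or_cofinal_not dominates_directed P

/-- A cofinal class's scope piece is the whole of `Res_K`. [folklore] -/
theorem resKRestr_iff_resK_of_cofinal {P : ProperModel k K → Prop} (hP : ModelsCofinal P) :
    ResKRestr P ↔ ResK k K :=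
  restricted_iff_all_of_cofinal hasResolution_antitone hP

/-- **Every scope bisection of `Res_K` has a `Res_K`-strength half**: for every predicate `P` on proper
models of `K/k`, `(P cofinal ∧ (Res_K|P ⟺ Res_K)) ∨ (¬P cofinal ∧ (Res_K|¬P ⟺ Res_K))`. [folklore] -/
theorem bisection_absorbs (P : ProperModel k K → Prop) :
    (ModelsCofinal P ∧ (ResKRestr P ↔ ResK k K)) ∨
      (ModelsCofinal (fun M => ¬ P M) ∧ (ResKRestr (fun M => ¬ P M) ↔ ResK k K)) :=
  DominanceDominationDichotomy.bisection_absorbs dominates_directed hasResolution_antitone P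

/-- The scope bisection itself is always exact (excluded middle), whichever half is load-bearing.
[folklore] -/
theorem resK_iff_restr_and_restr_not (P : ProperModel k K → Prop) :
    ResK k K ↔ ResKRestr P ∧ ResKRestr (fun M => ¬ P M) :=
  all_iff_restricted_and_restricted_not P

/-! ### §2b The same over a FIXED regular (or any) base model

The cell's residual is stated per fixed base `Y`; the models lying over a fixed proper model `R` form a
directed sub-preorder (the join of two models over `R` lies over `R`), so the dichotomy and absorption
hold verbatim INSIDE the sandwich class over `R`. -/

/-- Proper models of `K/k` lying over the fixed model `R`. [folklore] -/
def OverModel (R : ProperModel k K) : Type (u + 1) :=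
  {M : ProperModel k K // Dominates M R}

/-- Domination restricted to models over `R` is directed. [folklore] -/
theorem overModel_directed (R : ProperModel k K) :
    IsDirected' (fun N M : OverModel R => Dominates N.1 M.1) := fun M₁ M₂ =>
  ⟨⟨ProperModel.join M₁.1 M₂.1,
      Dominates.trans (N := M₁.1) ⟨ProperModel.joinFst M₁.1 M₂.1⟩ M₁.2⟩,
    ⟨ProperModel.joinFst M₁.1 M₂.1⟩, ⟨ProperModel.joinSnd M₁.1 M₂.1⟩⟩

/-- **Fixed-base dichotomy**: for every predicate `P` on the models over a fixed `R`, `P`-models or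
`¬P`-models are cofinal over `R`, and the cofinal colour's piece is resolution of ALL models over `R`.
[folklore] -/
theorem overModel_bisection_absorbs (R : ProperModel k K) (P : ProperModel k K → Prop) :
    (Cofinal (fun N M : OverModel R => Dominates N.1 M.1) (fun M => P M.1) ∧
        ((∀ M : OverModel R, P M.1 → Scheme.HasResolution M.1.X) ↔
          ∀ M : OverModel R, Scheme.HasResolution M.1.X)) ∨
      (Cofinal (fun N M : OverModel R => Dominates N.1 M.1) (fun M => ¬ P M.1) ∧
        ((∀ M : OverModel R, ¬ P M.1 → Scheme.HasResolution M.1.X) ↔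
          ∀ M : OverModel R, Scheme.HasResolution M.1.X)) :=
  DominanceDominationDichotomy.bisection_absorbs (overModel_directed R)
    (fun M N h hN => hasResolution_of_dominates (N := N.1) (M := M.1) h hN) (fun M => P M.1)

/-! ### §3 Worked colours -/

/-- The class of regular proper models. [folklore] -/
def IsRegularModel (M : ProperModel k K) : Prop :=
  Scheme.IsRegular M.X

/-- Regular models are cofinal ⟺ every proper model of `K` has a resolution. [folklore] -/
theorem cofinal_regular_iff_resK : ModelsCofinal (IsRegularModel (k := k) (K := K)) ↔ ResK k K := by
  refine ⟨fun h M => ?_, fun h M => ?_⟩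
  · obtain ⟨N, ⟨φ⟩, hN⟩ := h M
    exact φ.hasResolution hN
  · obtain ⟨N, φ, hN⟩ := M.exists_hom_isRegular_of_hasResolution (h M)
    exact ⟨N, ⟨φ⟩, hN⟩

/-- `RegModelAt k K`: the function field `K/k` has a regular proper model (the existence half, per
function field; `ProperModel.RegModel p` is this for all `K` of characteristic `p`; a predicate ON `K/k`,
not a closed statement). [definition] -/
def RegModelAt (k K : Type u) [Field k] [Field K] [Algebra k K] : Prop :=
  ∃ R : ProperModel k K, Scheme.IsRegular R.X

/-- `DominatesRegular M`: the model lies over SOME regular proper model — the proper-model form of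
«sandwiched over a regular base» (Dominance's `SandwichedResolve` scope, per function field). [folklore] -/
def DominatesRegular (M : ProperModel k K) : Prop :=
  ∃ R : ProperModel k K, Scheme.IsRegular R.X ∧ Dominates M R

/-- **The colour is decided by the function field (cofinal side).** If `K` has a regular proper model
`R`, models lying over a regular model are cofinal: `J(M, R)` dominates `M` and lies over `R`. [folklore] -/
theorem cofinal_dominatesRegular_of (h : RegModelAt k K) :
    ModelsCofinal (DominatesRegular (k := k) (K := K)) := fun M => by
  obtain ⟨R, hR⟩ := h
  exact ⟨ProperModel.join M R, ⟨ProperModel.joinFst M R⟩, R, hR, ⟨ProperModel.joinSnd M R⟩⟩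

/-- Conversely cofinality of that class produces a regular model (given one model at all). [folklore] -/
theorem regModelAt_of_cofinal_dominatesRegular (M₀ : ProperModel k K)
    (h : ModelsCofinal (DominatesRegular (k := k) (K := K))) : RegModelAt k K := by
  obtain ⟨_, _, R, hR, _⟩ := h M₀
  exact ⟨R, hR⟩

/-- `DominatesRegular` is cofinal ⟺ `K` has a regular proper model (for `K` with a proper model).
[folklore] -/
theorem cofinal_dominatesRegular_iff_regModelAt (M₀ : ProperModel k K) :
    ModelsCofinal (DominatesRegular (k := k) (K := K)) ↔ RegModelAt k K :=
  ⟨regModelAt_of_cofinal_dominatesRegular M₀, cofinal_dominatesRegular_of⟩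

/-- **The colour is decided by the function field (complement side).** `¬DominatesRegular` is cofinal
⟺ `K` has NO regular proper model: a regular `R` lies over itself, and so does everything dominating
it; with no regular model the class is everything. [folklore] -/
theorem cofinal_not_dominatesRegular_iff :
    ModelsCofinal (fun M : ProperModel k K => ¬ DominatesRegular M) ↔ ¬ RegModelAt k K := by
  refine ⟨fun hc ⟨R, hR⟩ => ?_, fun h M => ⟨M, dominates_refl M, fun ⟨R, hR, _⟩ => h ⟨R, hR⟩⟩⟩
  obtain ⟨N, hNR, hN⟩ := hc R
  exact hN ⟨R, hR, hNR⟩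

/-- `SandwichRes_K := Res_K|DominatesRegular` — resolve the proper models of `K` lying over a regular
proper model: the proper-model form, per function field, of Dominance's residual `SandwichedResolve`
(24572) and of `TwoModelPatching`'s open content (a predicate ON `K/k`, not a closed statement). [definition] -/
def SandwichResK (k K : Type u) [Field k] [Field K] [Algebra k K] : Prop :=
  ResKRestr (DominatesRegular (k := k) (K := K))

/-- **Dominance exactness per function field**: as soon as `K` has ONE regular proper model, the
sandwiched piece is the WHOLE of `Res_K` (it is the cofinal colour). [folklore] -/
theorem sandwichResK_iff_resK (h : RegModelAt k K) : SandwichResK k K ↔ ResK k K :=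
  resKRestr_iff_resK_of_cofinal (cofinal_dominatesRegular_of h)

/-- Without a regular model the sandwiched piece is vacuous and `Res_K` is false (given a model).
[folklore] -/
theorem sandwichResK_of_not_regModelAt (h : ¬ RegModelAt k K) : SandwichResK k K :=
  fun _ ⟨R, hR, _⟩ => (h ⟨R, hR⟩).elim

/-- `Res_K` produces a regular model (given a model). [folklore] -/
theorem regModelAt_of_resK (M₀ : ProperModel k K) (h : ResK k K) : RegModelAt k K := by
  obtain ⟨N, -, hN⟩ := M₀.exists_hom_isRegular_of_hasResolution (h M₀)
  exact ⟨N, hN⟩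

/-- **`Res_K ⟺ RegModelAt ∧ SandwichRes_K`** (for `K` with a proper model): the function-field carving
by «has a regular proper model», existence half ∧ cofinal residual. [folklore] -/
theorem resK_iff_regModelAt_and_sandwichResK (M₀ : ProperModel k K) :
    ResK k K ↔ RegModelAt k K ∧ SandwichResK k K :=
  ⟨fun h => ⟨regModelAt_of_resK M₀ h, fun M _ => h M⟩,
    fun h => (sandwichResK_iff_resK h.1).mp h.2⟩

/-- **The vacuous-half lemma.** For a class `Q` containing every resolvable model, the scope piece
`Res_K|¬Q` IS the existence statement `∀ M, Q M`. (With `Q M :⟺ K has a regular model` this is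
`RegModel`; with `Q M :⟺ K is finite purely inseparable over a field with a regular model` it is
`Pialt`; the certified-WEAKER pieces of the cell are exactly of this form.) [folklore] -/
theorem restr_not_iff_forall {Q : ProperModel k K → Prop}
    (hQ : ∀ M : ProperModel k K, Scheme.HasResolution M.X → Q M) :
    ResKRestr (fun M => ¬ Q M) ↔ ∀ M, Q M := by
  classical
  refine ⟨fun h M => ?_, fun h M hM => (hM (h M)).elim⟩
  by_contra hM
  exact hM (hQ M (h M hM))

/-- Instance of the vacuous-half lemma: the piece `Res_K|{K has no regular model}` is the existence
statement `RegModelAt` (for `K` with a proper model). [folklore] -/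
theorem regModelAt_iff_vacuousHalf (M₀ : ProperModel k K) :
    ResKRestr (fun _ : ProperModel k K => ¬ RegModelAt k K) ↔ RegModelAt k K := by
  rw [restr_not_iff_forall (Q := fun _ => RegModelAt k K) fun M hM => regModelAt_of_hasResolution M hM]
  exact ⟨fun h => h M₀, fun h _ => h⟩
where
  /-- a resolvable model yields a regular model [folklore] -/
  regModelAt_of_hasResolution (M : ProperModel k K) (hM : Scheme.HasResolution M.X) :
      RegModelAt k K := by
    obtain ⟨N, -, hN⟩ := M.exists_hom_isRegular_of_hasResolution hM
    exact ⟨N, hN⟩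

/-- **Absorbing predicates close by themselves.** If a class `P` of models is cofinal for `K` (e.g. «has
a wild point», «torus-free», «contact-free somewhere», «non-punctual exceptional locus» — each made
cofinal by one blow-up at a regular point), its scope piece is `Res_K`. [folklore] -/
theorem resK_of_cofinal_piece {P : ProperModel k K → Prop} (hP : ModelsCofinal P)
    (h : ResKRestr P) : ResK k K :=
  (resKRestr_iff_resK_of_cofinal hP).mp h

end Models

end Summit.ResolutionOfSingularities.ResolutionOfSingularities.Theorems.DominanceDominationDichotomy

end
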